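import Summits.QuantumFields.YangMills.Theorems.ColdStartUniversalityLatticeLangevinHeatKernelPositivity
import HarnessLib

/-!
# Route `ColdStartUniversality` (fixed-cut-off package, `β' = 0`): trace balls are a neighbourhood basis of `1` in `SU(2)`, and the
# SU(2) heat kernel has second moment `∫ (1 − Re tr/2)² h_t = 5/4 − 2e^{−3t/2} + ¾e^{−4t} ≤ 17 t²`

Helper file (seat `ym-line-csu-p1`, g12, free hands).  Inputs for the SU(2) INHABITANT of the tree's hypothesis structure
`Literature.MathematicalPhysics.QuantumLattice.IsGroupHeatKernel` (sequel `…HeatKernelGroupHeatKernel`): the approximate-identity and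
no-jump fields need (a) that every neighbourhood of `1 ∈ SU(2)` contains a trace ball `{V | 1 − Re tr V/2 < ρ}` and (b) a
second-moment bound of the kernel.  With `x(V) = Re tr V/2` and `h_t(V) = Σ (n+1) e^{-n(n+2)t/2} χ_n(V)` (inline):

* `eq_one_of_re_trace_div_two_eq_one` — `x(V) = 1 ⇒ V = 1` (unitarity of the rows + `V† = adj V`);
* ★ `exists_lt_trace_subset_of_mem_nhds` — every `U ∈ 𝓝 1` contains some trace ball (compactness: the closed trace balls are a
  directed family of compact sets with intersection `{1}`);
* `su2Char_one_eq`, `su2Char_two_eq` — `χ_1 = 2x`, `χ_2 = 4x² − 1`; `integral_su2Char_mul_heatKernelSU2_one` — `∫ χ_m h_t = (m+1)e^{-m(m+2)t/2}`;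
* ★ `integral_one_sub_sq_mul_heatKernelSU2` — `∫ (1 − x)² h_t dV = 5/4 − 2e^{−3t/2} + ¾ e^{−4t}`, and `…_le` — `≤ 17 t²` for `t ≤ 1/4`;
* `setIntegral_heatKernelSU2_le_div` — Chebyshev: `∫_S h_t ≤ (∫ (1−x)² h_t)/ρ²` whenever `1 − x ≥ ρ` on `S`.

THEOREMS ONLY, [folklore]; RECORD-rung R3 plumbing; no crux, rung or summit is proved here; the Yang–Mills mass gap is NOT proved.
-/

set_option autoImplicit false

noncomputable section

namespace Summit.QuantumFields.YangMills.Theorems.ColdStartUniversality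

open MeasureTheory Finset Filter Topology
open scoped BigOperators Topology Matrix
open Literature.MathematicalPhysics.QuantumFieldTheory
open Literature.MathematicalPhysics.QuantumFieldTheory.Tomboulis2007 (su2Char)
open Literature.Analysis.SpecialFunctions (gegenbauerSum gegenbauerSum_one gegenbauerSum_zero)
open Literature.Computability.QuantumComplexity (star_coe_eq_adjugate)

/-! ## `x(V) = 1` only at the identity; trace balls are a neighbourhood basis -/

/-- In `SU(2)`, `Re tr V / 2 = 1` forces `V = 1`. [folklore] -/
theorem eq_one_of_re_trace_div_two_eq_one (V : Matrix.specialUnitaryGroup (Fin 2) ℂ)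
    (h : ((V : Matrix (Fin 2) (Fin 2) ℂ)).trace.re / 2 = 1) : V = 1 := by
  set A : Matrix (Fin 2) (Fin 2) ℂ := (V : Matrix (Fin 2) (Fin 2) ℂ) with hA
  have hmem := Matrix.mem_specialUnitaryGroup_iff.1 V.2
  have hAu : A * star A = 1 := Matrix.mem_unitaryGroup_iff.1 hmem.1
  have hstar : star A = Matrix.adjugate A := star_coe_eq_adjugate V
  -- entries of `A† = adj A`
  have e11 : star (A 1 1) = A 0 0 := by
    have := congrFun (congrFun hstar 1) 1
    rw [Matrix.star_eq_conjTranspose, Matrix.conjTranspose_apply, Matrix.adjugate_fin_two] at this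
    simpa using this
  have e01 : star (A 1 0) = -A 0 1 := by
    have := congrFun (congrFun hstar 0) 1
    rw [Matrix.star_eq_conjTranspose, Matrix.conjTranspose_apply, Matrix.adjugate_fin_two] at this
    simpa using this
  have hA11 : A 1 1 = star (A 0 0) := by rw [← e11, star_star]
  -- row `0` of `A A† = 1`
  have hrow : A 0 0 * star (A 0 0) + A 0 1 * star (A 0 1) = 1 := by
    have := congrFun (congrFun hAu 0) 0
    rw [Matrix.mul_apply, Fin.sum_univ_two] at this
    simpa [Matrix.star_eq_conjTranspose, Matrix.conjTranspose_apply] using this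
  have hns : Complex.normSq (A 0 0) + Complex.normSq (A 0 1) = 1 := by
    have h2 := congrArg Complex.re hrow
    simp only [Complex.add_re, Complex.mul_re, Complex.star_def, Complex.conj_re, Complex.conj_im, Complex.one_re] at h2
    rw [Complex.normSq_apply, Complex.normSq_apply]
    linear_combination h2
  -- `Re A₀₀ = 1`
  have htr : A.trace.re = 2 * (A 0 0).re := by
    rw [Matrix.trace_fin_two, Complex.add_re, hA11, Complex.star_def, Complex.conj_re]; ring
  have hre : (A 0 0).re = 1 := by
    have h' : A.trace.re / 2 = 1 := h
    linarith
  have h00sq : Complex.normSq (A 0 0) = (A 0 0).re * (A 0 0).re + (A 0 0).im * (A 0 0).im := Complex.normSq_apply _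
  have h01nn : 0 ≤ Complex.normSq (A 0 1) := Complex.normSq_nonneg _
  have him : (A 0 0).im = 0 := by nlinarith [sq_nonneg (A 0 0).im]
  have hA00 : A 0 0 = 1 := Complex.ext (by simp [hre]) (by simp [him])
  have hA01 : A 0 1 = 0 := Complex.normSq_eq_zero.1 (by nlinarith [sq_nonneg (A 0 0).im])
  have hA11' : A 1 1 = 1 := by rw [hA11, hA00, star_one]
  have hA10 : A 1 0 = 0 := by
    have h' : star (A 1 0) = 0 := by rw [e01, hA01, neg_zero]
    exact star_eq_zero.1 h'
  apply Subtype.ext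
  show A = ((1 : Matrix.specialUnitaryGroup (Fin 2) ℂ) : Matrix (Fin 2) (Fin 2) ℂ)
  ext i j
  fin_cases i <;> fin_cases j <;> simp [hA00, hA01, hA10, hA11']

/-- `x(V) = Re tr V/2` is continuous on `SU(2)`. [folklore] -/
theorem continuous_re_trace_div_two :
    Continuous fun V : Matrix.specialUnitaryGroup (Fin 2) ℂ => ((V : Matrix (Fin 2) (Fin 2) ℂ)).trace.re / 2 :=
  (Complex.continuous_re.comp (continuous_subtype_val.matrix_trace)).div_const _

/-- ★ **Trace balls are a neighbourhood basis of `1` in `SU(2)`**: every neighbourhood `U` of `1` contains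
`{V | 1 − Re tr V/2 < ρ}` for some `ρ > 0` (the closed trace balls are compact, directed, with intersection `{1}`). [folklore] -/
theorem exists_lt_trace_subset_of_mem_nhds {U : Set (Matrix.specialUnitaryGroup (Fin 2) ℂ)}
    (hU : U ∈ 𝓝 (1 : Matrix.specialUnitaryGroup (Fin 2) ℂ)) :
    ∃ ρ : ℝ, 0 < ρ ∧ ∀ V : Matrix.specialUnitaryGroup (Fin 2) ℂ,
      1 - ((V : Matrix (Fin 2) (Fin 2) ℂ)).trace.re / 2 < ρ → V ∈ U := by
  have hxc : Continuous fun V : Matrix.specialUnitaryGroup (Fin 2) ℂ => 1 - ((V : Matrix (Fin 2) (Fin 2) ℂ)).trace.re / 2 :=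
    continuous_const.sub continuous_re_trace_div_two
  set W : {ρ : ℝ // 0 < ρ} → Set (Matrix.specialUnitaryGroup (Fin 2) ℂ) :=
    fun ρ => {V | 1 - ((V : Matrix (Fin 2) (Fin 2) ℂ)).trace.re / 2 ≤ ρ.1} with hW
  haveI : Nonempty {ρ : ℝ // 0 < ρ} := ⟨⟨1, one_pos⟩⟩
  have hdir : Directed (· ⊇ ·) W := by
    intro ρ₁ ρ₂
    refine ⟨⟨min ρ₁.1 ρ₂.1, lt_min ρ₁.2 ρ₂.2⟩, ?_, ?_⟩
    · intro V hV
      simp only [hW, Set.mem_setOf_eq] at hV ⊢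
      exact le_trans hV (min_le_left _ _)
    · intro V hV
      simp only [hW, Set.mem_setOf_eq] at hV ⊢
      exact le_trans hV (min_le_right _ _)
  have hclosed : ∀ ρ, IsClosed (W ρ) := fun ρ => isClosed_le hxc continuous_const
  have hcpt : ∀ ρ, IsCompact (W ρ) := fun ρ => (hclosed ρ).isCompact
  have hU' : ∀ y ∈ ⋂ ρ, W ρ, U ∈ 𝓝 y := by
    intro y hy
    have hle : ∀ ρ : ℝ, 0 < ρ → 1 - ((y : Matrix (Fin 2) (Fin 2) ℂ)).trace.re / 2 ≤ ρ :=
      fun ρ hρ => Set.mem_iInter.1 hy ⟨ρ, hρ⟩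
    have hx1 := (re_trace_div_two_mem y).2
    have h1 : ((y : Matrix (Fin 2) (Fin 2) ℂ)).trace.re / 2 = 1 := by
      by_contra hne
      have hlt : ((y : Matrix (Fin 2) (Fin 2) ℂ)).trace.re / 2 < 1 := lt_of_le_of_ne hx1 hne
      have := hle ((1 - ((y : Matrix (Fin 2) (Fin 2) ℂ)).trace.re / 2) / 2) (by linarith)
      linarith
    rw [eq_one_of_re_trace_div_two_eq_one y h1]
    exact hU
  obtain ⟨ρ, hρ⟩ := exists_subset_nhds_of_isCompact' hdir hcpt hclosed hU'
  exact ⟨ρ.1, ρ.2, fun V hV => hρ (le_of_lt hV)⟩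

/-! ## Low characters and the second moment of the heat kernel -/

/-- `χ_1(V) = Re tr V`. [folklore] -/
theorem su2Char_one_eq (V : Matrix.specialUnitaryGroup (Fin 2) ℂ) :
    su2Char 1 V = 2 * (((V : Matrix (Fin 2) (Fin 2) ℂ)).trace.re / 2) := by
  rw [su2Char_eq_gegenbauerSum, gegenbauerSum_one]; ring

/-- `χ_2(V) = 4 (Re tr V/2)² − 1`. [folklore] -/
theorem su2Char_two_eq (V : Matrix.specialUnitaryGroup (Fin 2) ℂ) :
    su2Char 2 V = 4 * (((V : Matrix (Fin 2) (Fin 2) ℂ)).trace.re / 2) ^ 2 - 1 := by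
  have h := gegenbauerSum_one_succ_succ 0 (((V : Matrix (Fin 2) (Fin 2) ℂ)).trace.re / 2)
  simp only [Nat.zero_add] at h
  rw [su2Char_eq_gegenbauerSum, h, gegenbauerSum_one, gegenbauerSum_zero]; ring

/-- `∫ χ_m h_t dV = (m+1) e^{-m(m+2)t/2}`. [folklore] -/
theorem integral_su2Char_mul_heatKernelSU2_one {t : ℝ} (ht : 0 < t) (m : ℕ) :
    ∫ V, su2Char m V * (∑' n : ℕ, ((n : ℝ) + 1) * Real.exp (-((n : ℝ) * ((n : ℝ) + 2) / 2) * t) * su2Char n V)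
        ∂(haarProbability (Matrix.specialUnitaryGroup (Fin 2) ℂ)) =
      Real.exp (-((m : ℝ) * ((m : ℝ) + 2) / 2) * t) * ((m : ℝ) + 1) := by
  have h := integral_su2Char_mul_heatKernelSU2 ht m 1 1
  simp only [inv_one, mul_one] at h
  rw [h, su2Char_one_apply]

/-- The heat kernel and its products with continuous bounded factors are integrable: `∫ |φ h_t| < ∞` for continuous `φ` with
`|φ| ≤ B`. [folklore] -/
theorem integrable_mul_heatKernelSU2 {t : ℝ} (ht : 0 < t) {φ : Matrix.specialUnitaryGroup (Fin 2) ℂ → ℝ} (hφ : Continuous φ)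
    {B : ℝ} (hB : ∀ V, |φ V| ≤ B) :
    Integrable (fun V => φ V * ∑' n : ℕ, ((n : ℝ) + 1) * Real.exp (-((n : ℝ) * ((n : ℝ) + 2) / 2) * t) * su2Char n V)
      (haarProbability (Matrix.specialUnitaryGroup (Fin 2) ℂ)) := by
  haveI : IsProbabilityMeasure (haarProbability (Matrix.specialUnitaryGroup (Fin 2) ℂ)) := inferInstance
  refine Integrable.of_bound (hφ.mul (continuous_heatKernelSU2 ht)).measurable.aestronglyMeasurable
    (B * ∑' n : ℕ, ((n : ℝ) + 1) ^ 2 * Real.exp (-((n : ℝ) * ((n : ℝ) + 2) / 2) * t)) (Eventually.of_forall fun V => ?_)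
  rw [Real.norm_eq_abs, abs_mul]
  exact mul_le_mul (hB V) (abs_heatKernelSU2_le_majorant ht V) (abs_nonneg _) ((abs_nonneg _).trans (hB V))

/-- ★ **Second moment of the SU(2) heat kernel**: `∫ (1 − Re tr V/2)² h_t(V) dV = 5/4 − 2 e^{−3t/2} + ¾ e^{−4t}`
(`(1 − x)² = (5/4)χ_0 − χ_1 + ¼χ_2` and `∫ χ_m h_t = (m+1) e^{-m(m+2)t/2}`). [folklore] -/
theorem integral_one_sub_sq_mul_heatKernelSU2 {t : ℝ} (ht : 0 < t) :
    ∫ V, (1 - ((V : Matrix (Fin 2) (Fin 2) ℂ)).trace.re / 2) ^ 2 *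
        (∑' n : ℕ, ((n : ℝ) + 1) * Real.exp (-((n : ℝ) * ((n : ℝ) + 2) / 2) * t) * su2Char n V)
        ∂(haarProbability (Matrix.specialUnitaryGroup (Fin 2) ℂ)) =
      5 / 4 - 2 * Real.exp (-(3 / 2) * t) + 3 / 4 * Real.exp (-4 * t) := by
  -- pointwise: `(1 − x)² h = (5/4)(χ_0 h) − (χ_1 h) + (1/4)(χ_2 h)`
  have hpt : ∀ V : Matrix.specialUnitaryGroup (Fin 2) ℂ,
      (1 - ((V : Matrix (Fin 2) (Fin 2) ℂ)).trace.re / 2) ^ 2 *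
        (∑' n : ℕ, ((n : ℝ) + 1) * Real.exp (-((n : ℝ) * ((n : ℝ) + 2) / 2) * t) * su2Char n V) =
      (5 / 4) * (su2Char 0 V * ∑' n : ℕ, ((n : ℝ) + 1) * Real.exp (-((n : ℝ) * ((n : ℝ) + 2) / 2) * t) * su2Char n V) -
        su2Char 1 V * (∑' n : ℕ, ((n : ℝ) + 1) * Real.exp (-((n : ℝ) * ((n : ℝ) + 2) / 2) * t) * su2Char n V) +
        (1 / 4) * (su2Char 2 V * ∑' n : ℕ, ((n : ℝ) + 1) * Real.exp (-((n : ℝ) * ((n : ℝ) + 2) / 2) * t) * su2Char n V) := by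
    intro V
    rw [su2Char_zero_apply, su2Char_one_eq, su2Char_two_eq]; ring
  simp_rw [hpt]
  have hχ : ∀ m : ℕ, ∀ V : Matrix.specialUnitaryGroup (Fin 2) ℂ, |su2Char m V| ≤ (m : ℝ) + 1 := fun m V => abs_su2Char_le' m V
  have hi : ∀ m : ℕ, Integrable (fun V => su2Char m V *
      ∑' n : ℕ, ((n : ℝ) + 1) * Real.exp (-((n : ℝ) * ((n : ℝ) + 2) / 2) * t) * su2Char n V)
      (haarProbability (Matrix.specialUnitaryGroup (Fin 2) ℂ)) :=
    fun m => integrable_mul_heatKernelSU2 ht (continuous_su2Char_apply m) (hχ m)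
  have hF0 : Integrable (fun V : Matrix.specialUnitaryGroup (Fin 2) ℂ => (5 / 4 : ℝ) * (su2Char 0 V *
      ∑' n : ℕ, ((n : ℝ) + 1) * Real.exp (-((n : ℝ) * ((n : ℝ) + 2) / 2) * t) * su2Char n V))
      (haarProbability (Matrix.specialUnitaryGroup (Fin 2) ℂ)) := (hi 0).const_mul _
  have hF2 : Integrable (fun V : Matrix.specialUnitaryGroup (Fin 2) ℂ => (1 / 4 : ℝ) * (su2Char 2 V *
      ∑' n : ℕ, ((n : ℝ) + 1) * Real.exp (-((n : ℝ) * ((n : ℝ) + 2) / 2) * t) * su2Char n V))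
      (haarProbability (Matrix.specialUnitaryGroup (Fin 2) ℂ)) := (hi 2).const_mul _
  have hF01 : Integrable (fun V : Matrix.specialUnitaryGroup (Fin 2) ℂ => (5 / 4 : ℝ) * (su2Char 0 V *
      ∑' n : ℕ, ((n : ℝ) + 1) * Real.exp (-((n : ℝ) * ((n : ℝ) + 2) / 2) * t) * su2Char n V) -
      su2Char 1 V * ∑' n : ℕ, ((n : ℝ) + 1) * Real.exp (-((n : ℝ) * ((n : ℝ) + 2) / 2) * t) * su2Char n V)
      (haarProbability (Matrix.specialUnitaryGroup (Fin 2) ℂ)) := hF0.sub (hi 1)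
  rw [integral_add hF01 hF2, integral_sub hF0 (hi 1), integral_const_mul, integral_const_mul,
    integral_su2Char_mul_heatKernelSU2_one ht 0, integral_su2Char_mul_heatKernelSU2_one ht 1,
    integral_su2Char_mul_heatKernelSU2_one ht 2]
  have e0 : Real.exp (-(((0 : ℕ) : ℝ) * (((0 : ℕ) : ℝ) + 2) / 2) * t) = 1 := by norm_num
  have e1 : Real.exp (-(((1 : ℕ) : ℝ) * (((1 : ℕ) : ℝ) + 2) / 2) * t) = Real.exp (-(3 / 2) * t) := by
    congr 1; push_cast; ring
  have e2 : Real.exp (-(((2 : ℕ) : ℝ) * (((2 : ℕ) : ℝ) + 2) / 2) * t) = Real.exp (-4 * t) := by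
    congr 1; push_cast; ring
  rw [e0, e1, e2]
  push_cast
  ring

/-- **Second-moment bound at small times**: `∫ (1 − Re tr V/2)² h_t(V) dV ≤ 17 t²` for `0 < t ≤ 1/4`. [folklore] -/
theorem integral_one_sub_sq_mul_heatKernelSU2_le {t : ℝ} (ht : 0 < t) (ht4 : t ≤ 1 / 4) :
    ∫ V, (1 - ((V : Matrix (Fin 2) (Fin 2) ℂ)).trace.re / 2) ^ 2 *
        (∑' n : ℕ, ((n : ℝ) + 1) * Real.exp (-((n : ℝ) * ((n : ℝ) + 2) / 2) * t) * su2Char n V)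
        ∂(haarProbability (Matrix.specialUnitaryGroup (Fin 2) ℂ)) ≤ 17 * t ^ 2 := by
  rw [integral_one_sub_sq_mul_heatKernelSU2 ht]
  have h1 := Real.abs_exp_sub_one_sub_id_le (x := -(3 / 2) * t) (by rw [abs_le]; constructor <;> linarith)
  have h2 := Real.abs_exp_sub_one_sub_id_le (x := -4 * t) (by rw [abs_le]; constructor <;> linarith)
  rw [abs_le] at h1 h2
  nlinarith [h1.1, h1.2, h2.1, h2.2]

/-- **Chebyshev tail bound**: if `1 − Re tr/2 ≥ ρ > 0` on `S` then `∫_S h_t ≤ (∫ (1 − Re tr/2)² h_t)/ρ²`. [folklore] -/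
theorem setIntegral_heatKernelSU2_le_div {t : ℝ} (ht : 0 < t) {ρ : ℝ} (hρ : 0 < ρ)
    {S : Set (Matrix.specialUnitaryGroup (Fin 2) ℂ)}
    (hS : ∀ V ∈ S, ρ ≤ 1 - ((V : Matrix (Fin 2) (Fin 2) ℂ)).trace.re / 2) :
    ∫ V in S, (∑' n : ℕ, ((n : ℝ) + 1) * Real.exp (-((n : ℝ) * ((n : ℝ) + 2) / 2) * t) * su2Char n V)
        ∂(haarProbability (Matrix.specialUnitaryGroup (Fin 2) ℂ)) ≤
      (∫ V, (1 - ((V : Matrix (Fin 2) (Fin 2) ℂ)).trace.re / 2) ^ 2 *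
        (∑' n : ℕ, ((n : ℝ) + 1) * Real.exp (-((n : ℝ) * ((n : ℝ) + 2) / 2) * t) * su2Char n V)
        ∂(haarProbability (Matrix.specialUnitaryGroup (Fin 2) ℂ))) / ρ ^ 2 := by
  set h : Matrix.specialUnitaryGroup (Fin 2) ℂ → ℝ := fun V =>
    ∑' n : ℕ, ((n : ℝ) + 1) * Real.exp (-((n : ℝ) * ((n : ℝ) + 2) / 2) * t) * su2Char n V with hh
  set B : Set (Matrix.specialUnitaryGroup (Fin 2) ℂ) := {V | ρ ≤ 1 - ((V : Matrix (Fin 2) (Fin 2) ℂ)).trace.re / 2} with hB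
  have hBm : MeasurableSet B := (isClosed_le continuous_const (continuous_const.sub continuous_re_trace_div_two)).measurableSet
  have hSB : S ⊆ B := fun V hV => hS V hV
  have h0 : ∀ V, 0 ≤ h V := fun V => heatKernelSU2_nonneg ht V
  have hint : Integrable h (haarProbability (Matrix.specialUnitaryGroup (Fin 2) ℂ)) := by
    have := integrable_mul_heatKernelSU2 ht (φ := fun _ => (1 : ℝ)) continuous_const (B := 1) (fun _ => by simp)
    simpa [hh] using this
  have hx2 : ∀ V : Matrix.specialUnitaryGroup (Fin 2) ℂ, |(1 - ((V : Matrix (Fin 2) (Fin 2) ℂ)).trace.re / 2) ^ 2 / ρ ^ 2| ≤ 4 / ρ ^ 2 := by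
    intro V
    have hm := re_trace_div_two_mem V
    rw [abs_of_nonneg (by positivity)]
    exact div_le_div_of_nonneg_right (by nlinarith [hm.1, hm.2]) (by positivity)
  have hint2 : Integrable (fun V : Matrix.specialUnitaryGroup (Fin 2) ℂ =>
      (1 - ((V : Matrix (Fin 2) (Fin 2) ℂ)).trace.re / 2) ^ 2 / ρ ^ 2 * h V)
      (haarProbability (Matrix.specialUnitaryGroup (Fin 2) ℂ)) :=
    integrable_mul_heatKernelSU2 ht (((continuous_const.sub continuous_re_trace_div_two).pow 2).div_const _) hx2
  calc ∫ V in S, h V ∂(haarProbability (Matrix.specialUnitaryGroup (Fin 2) ℂ))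
      ≤ ∫ V in B, h V ∂(haarProbability (Matrix.specialUnitaryGroup (Fin 2) ℂ)) :=
        setIntegral_mono_set hint.integrableOn (Eventually.of_forall h0) (Eventually.of_forall hSB)
    _ ≤ ∫ V in B, (1 - ((V : Matrix (Fin 2) (Fin 2) ℂ)).trace.re / 2) ^ 2 / ρ ^ 2 * h V
          ∂(haarProbability (Matrix.specialUnitaryGroup (Fin 2) ℂ)) := by
        refine setIntegral_mono_on hint.integrableOn hint2.integrableOn hBm fun V hV => ?_
        have hV' : ρ ≤ 1 - ((V : Matrix (Fin 2) (Fin 2) ℂ)).trace.re / 2 := hV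
        have h1 : 1 ≤ (1 - ((V : Matrix (Fin 2) (Fin 2) ℂ)).trace.re / 2) ^ 2 / ρ ^ 2 := by
          rw [le_div_iff₀ (by positivity), one_mul]
          exact pow_le_pow_left₀ hρ.le hV' 2
        calc h V = 1 * h V := (one_mul _).symm
          _ ≤ _ := mul_le_mul_of_nonneg_right h1 (h0 V)
    _ ≤ ∫ V, (1 - ((V : Matrix (Fin 2) (Fin 2) ℂ)).trace.re / 2) ^ 2 / ρ ^ 2 * h V
          ∂(haarProbability (Matrix.specialUnitaryGroup (Fin 2) ℂ)) :=
        setIntegral_le_integral hint2 (Eventually.of_forall fun V => mul_nonneg (by positivity) (h0 V))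
    _ = (∫ V, (1 - ((V : Matrix (Fin 2) (Fin 2) ℂ)).trace.re / 2) ^ 2 * h V
          ∂(haarProbability (Matrix.specialUnitaryGroup (Fin 2) ℂ))) / ρ ^ 2 := by
        rw [← integral_div]
        exact integral_congr_ae (Eventually.of_forall fun V => by ring)

end Summit.QuantumFields.YangMills.Theorems.ColdStartUniversality

end
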